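import Summits.QuantumFields.BalabanUV.Beta.GAN24.BorderGaugeLegContact
import Summits.QuantumFields.BalabanUV.Beta.GAN24.ContactOneGaugeCellBound

/-!
# `GAN24.ContactBorderPartner` — CT-ROUTE step «CT-3aV», part 1: THE CONTACT PARTNER OF THE BORDER TABLE's ONE-GAUGE CELLS — an1's packed rooted first-order
# kernel `q = linSymAt ρ L` (support, size `ℓ`, the `2^{d+1}` coarse bonds near a fine site, `ℓ¹`-proximity of the contact sites), the INDEX-slot law in `dψ`-form,
# and the two CONTACT KERNELS `(ψ(u + e_κ) − ψ(z + ρ + L·e_μ))·q`, `(ψ(z + ρ) − ψ x)·q` ENVELOPED at the leg site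

HONEST FRAMING (cell charter, verbatim): «discharging `BetaPertH` makes Bałaban's UV stability UNCONDITIONAL — a real constructive-QFT result;
it is NOT the continuum limit and NOT the Clay problem.»  DERIVED cell leaf (pub-balaban, G-an2-4 formalisation swarm → CRUX TEAM (2), seat
`b2b-balaban-gan24-formalise-leaf-02`, gen 47; the row owner's CALL [GAN24P1-G19-P1] «→ leaf-02: the V∕H ONE-GAUGE CELL BOUNDS … = CT-3aV ∕ CT-3aH», V half, part 1 of 2):
[folklore] bookkeeping (floor division, one block-label wobble, the triangle inequality) over `GAN24.BorderGaugeLegContact`, an1's (S-V)ρ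
`AveragingWardRootedStencils.divV_vhSAt_apply`, `LinearGaugeVH.vhSAt_eq_zero_of_not_mem` and `EnvelopeBlockSum.env_wobble` BY NAME; NO cited fact, NO `def`,
NO `def … : Prop`, NO wall binder; constants symbolic.  Discharges NO letter of (CONV-C); NEVER «G-an2-4 closed»; NOT hS0, NOT D1, NOT `BetaPertH`, NOT continuum,
NOT Clay.  «not in print; our bookkeeping».
HONEST DEPENDENCY (cell records, verbatim): «continuum YM on T⁴ ⇐ BetaPertH ∧ nine spine estimates (0/9 proved); BetaPertH ⇐ (D1) ∧ (D4) ∧ CAP+tail;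
G-an2-4 gates asym, D1 and NE2/3/4.»
ABSOLUTE RULE (cell charter, verbatim): «No internally-minted statement may enter as a cited fact. Every hypothesis is either kernel-proved in this
package or a verbatim quotation of a PUBLISHED theorem with page reference. The manuscript(s) under audit are NOT citable for their own disputed steps —
they are the thing under adjudication; programme-internal (2001/route/tribunal) claims are never citable.»

THE OBJECTS (generic `d`, `ℤ^(d+1)`; the TABLE's one-step blocking `L ≥ 1` with a box root `ρ = toSite r`, `r ∈ box (d+1) L`; the LEGS' envelope blocking `N ≥ 1`,
`E_z(u) := e^{−κ₀‖quo N u − z‖∞}`; `ℓ := ell (d+1) L = (2d+4)·L`; `q := linSymAt ρ L`, `(inl κ, inr μ)` entry at `(u, z)` = `q¹,ρ_{(μ, z/L)}(κ, u)` on `z ∈ L·ℤ^(d+1)`).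
## What is proved
* §1 **`off_eq_zero_and_near_of_linSymAt_ne_zero`** (support: `z ∈ L·ℤ^(d+1)`, `u` in the `2L`-box of `z/L`; `linKerAt_eq_zero`), **`abs_linSymAt_inl_inr_le`** (`≤ ℓ`;
  `abs_linKerAt_le`), **`exists_finset_near_card`** (the coarse sites `y` with `Near L y u` lie in a set of `≤ 2^{d+1}` sites, each with `L·y_i ∈ (u_i − 2L, u_i]`),
  `l1_smul_sub_le_of_mem` ∕ `l1_farEnd_sub_le_of_mem` (`|L·y − u|₁, |L·y + ρ + L·e_μ − u|₁ ≤ (d+1)·2L`).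
* §2 **`tsum_dz_mul_vhSAt_idx`** — the INDEX-slot law of the border table in `dψ`-form for EVERY ψ (an1's (S-V)ρ by parts):
  `Σ'_u Σ_κ (dz ψ) κ u · V κ u x z a b = (ψ(legSite ρ z b) − ψ(legSite ρ x a)) · mfNeg (linSymAt ρ L) x z a b`; on `(inl α, inr μ)`: `(ψ(z + ρ) − ψ x)·q`.
* §3 THE CONTACT KERNELS ARE ENVELOPED AT THE LEG SITE (ψ under `Eψ·E_{z₀}`): `abs_weight_le_of_l1_le`, **`abs_fluWeight_mul_linSymAt_le`**
  `|(ψ(u + e_κ) − ψ(z + ρ + L·e_μ))·q(u,z)(inl κ)(inr μ)| ≤ (2Eψ·e^{2κ₀(d+1)L}·ℓ)·E_{z₀}(u)`, **`abs_idxWeight_mul_linSymAt_le`** `|(ψ(z + ρ) − ψ x)·q(x,z)(inl α)(inr μ)| ≤ (same)·E_{z₀}(x)`.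
Sequel (part 2): `GAN24.ContactOneGaugeCellBorder` — the generic cell bound and the two V cells.
Provenance: seat b2b-balaban-gan24-formalise-leaf-02 gen 47 (prover-…-leaf-02-g47-0), 2026-08-21; over the files named above BY NAME.
-/

open Finset
open scoped BigOperators Nat
open Literature.MathematicalPhysics.QuantumFieldTheory.LatticeForm (quo)
open Literature.MathematicalPhysics.QuantumFieldTheory.Balaban1983to89
open Literature.MathematicalPhysics.QuantumFieldTheory.Balaban1983to89.Beta
open AffineAveraging AveragingContours AveragingHessianKernels AveragingContoursRooted AveragingHessianKernelsRooted
open B12Sec2to5 (l1 l1_nonneg)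
open B4ContourShift (supNorm supNorm_nonneg)
open ExpKernelCalculus (MKer Zl Zl_nonneg Zl_pos)
open OneStepResolventKernel (Fib)
open StepJetData (mfNeg mfNeg_inl_inl mfNeg_inl_inr mfNeg_inr_inl mfNeg_inr_inr l1_unitVec)
open KernelWard (divV)
open AveragingWardStencils (b6UnitVec_eq)
open Summit.QuantumFields.BalabanUV.Beta.AveragingWardRootedStencils (linSymAt linSymAt_inl_inr linSymAt_inr_inl legSite legInd legInd_apply
  divV_vhSAt_apply)
open Summit.QuantumFields.BalabanUV.Beta.LinearGaugeVH (nearBox mem_nearBox summable_of_finsupp vhSAt_eq_zero_of_not_mem)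
open Summit.QuantumFields.BalabanUV.Beta.GAN24.EnvelopeBlockSum (env_wobble env_le_one summable_env)
open Summit.QuantumFields.BalabanUV.Beta.GAN24.ContactOneGaugeCellBound (tsum_env3_le abs_le_of_env summable_of_env)
open Summit.QuantumFields.BalabanUV.Beta.GAN24.BorderGaugeLegContact (tsum_mul_ite_sub_ite_mul tsum_sum_dz_mul_eq tsum_dz_mul_vhSAt)

noncomputable section

namespace Summit.QuantumFields.BalabanUV.Beta.GAN24.ContactBorderPartner

variable {d : ℕ}

/-! ## §1 The contact partner's letters: support, size, the finite near-box with its cardinal, proximity -/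

section Partner

/-- [folklore] SUPPORT of the packed first-order kernel (box root): a nonzero `(inl κ, inr μ)` entry at `(u, z)` forces `z ∈ L·ℤ^(d+1)` and `u` in the support box
of the block `z/L`. -/
theorem off_eq_zero_and_near_of_linSymAt_ne_zero {L : ℕ} {r : Fin (d + 1) → ℕ} (hr : r ∈ box (d + 1) L) {κ : Fin (d + 1)} {u z : Fin (d + 1) → ℤ}
    {μ : Fin (d + 1)} (h : linSymAt (toSite r) L u z (Sum.inl κ) (Sum.inr μ) ≠ 0) : off L z = 0 ∧ Near L (blk L z) u := by
  rw [linSymAt_inl_inr] at h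
  by_cases hz : off L z = 0
  · refine ⟨hz, ?_⟩
    by_contra hn
    exact h (by rw [if_pos hz, linKerAt_eq_zero hr (f := (κ, u)) hn])
  · exact absurd (by rw [if_neg hz]) h

/-- [folklore] SIZE of the packed first-order kernel (box root): `|q(u, z)(inl κ)(inr μ)| ≤ ℓ = (2d+2)·L` (`abs_linKerAt_le`). -/
theorem abs_linSymAt_inl_inr_le {L : ℕ} (hL : 1 ≤ L) {r : Fin (d + 1) → ℕ} (hr : r ∈ box (d + 1) L) (κ : Fin (d + 1)) (u z : Fin (d + 1) → ℤ)
    (μ : Fin (d + 1)) : |linSymAt (toSite r) L u z (Sum.inl κ) (Sum.inr μ)| ≤ (ell (d + 1) L : ℝ) := by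
  rw [linSymAt_inl_inr]
  split_ifs
  · exact abs_linKerAt_le hL μ (blk L z) hr (κ, u)
  · rw [abs_zero]; positivity

/-- [folklore] THE COARSE SITES WHOSE SUPPORT BOX CONTAINS A FINE SITE, WITH CARDINAL: there is a finite set of at most `2^{d+1}` coarse sites `y` such that every
`y` with `Near L y u` belongs to it, and every member satisfies `L·y_i ∈ (u_i − 2L, u_i]` coordinatewise. -/
theorem exists_finset_near_card {L : ℕ} (hL : 1 ≤ L) (u : Fin (d + 1) → ℤ) :
    ∃ s : Finset (Fin (d + 1) → ℤ), s.card ≤ 2 ^ (d + 1) ∧ (∀ y, Near L y u → y ∈ s) ∧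
      ∀ y ∈ s, ∀ i, u i - 2 * (L : ℤ) < (L : ℤ) * y i ∧ (L : ℤ) * y i ≤ u i := by
  have hL0 : (0 : ℤ) < (L : ℤ) := by exact_mod_cast hL
  refine ⟨Fintype.piFinset fun i => Finset.Icc (u i / (L : ℤ) - 1) (u i / (L : ℤ)), ?_, fun y hy => ?_, fun y hy i => ?_⟩
  · rw [Fintype.card_piFinset]
    refine le_of_eq ?_
    rw [show (2 : ℕ) ^ (d + 1) = ∏ _i : Fin (d + 1), 2 by simp]
    refine Finset.prod_congr rfl fun i _ => ?_
    rw [Int.card_Icc]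
    omega
  · rw [Fintype.mem_piFinset]
    intro i
    rw [Finset.mem_Icc]
    obtain ⟨h1, h2⟩ := hy i
    constructor
    · have h3 : u i < (y i + 2) * (L : ℤ) := by
        have h2' : u i ≤ (L : ℤ) * y i + (2 * (L : ℤ) - 1) := h2
        linarith
      have h4 : u i / (L : ℤ) < y i + 2 := Int.ediv_lt_of_lt_mul hL0 h3
      linarith
    · exact Int.le_ediv_of_mul_le hL0 (by rw [mul_comm]; exact h1)
  · rw [Fintype.mem_piFinset] at hy
    have hyi := hy i
    rw [Finset.mem_Icc] at hyi
    have hdiv : (L : ℤ) * (u i / (L : ℤ)) ≤ u i := Int.mul_ediv_self_le (by positivity)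
    have hlt : u i < (L : ℤ) * (u i / (L : ℤ)) + (L : ℤ) := by
      have := Int.lt_mul_ediv_self_add (x := u i) hL0
      linarith
    constructor <;> nlinarith [hyi.1, hyi.2]

/-- [folklore] PROXIMITY of the packed multiplier leg: for `y` in the near-set of `u`, `|L·y − u|₁ ≤ (d+1)·2L`. -/
theorem l1_smul_sub_le_of_mem {L : ℕ} {u y : Fin (d + 1) → ℤ} (hy : ∀ i, u i - 2 * (L : ℤ) < (L : ℤ) * y i ∧ (L : ℤ) * y i ≤ u i) :
    l1 ((L : ℤ) • y - u) ≤ ((d : ℝ) + 1) * (2 * (L : ℝ)) := by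
  unfold l1
  calc ∑ μ, |((((L : ℤ) • y - u) μ : ℤ) : ℝ)| ≤ ∑ _μ : Fin (d + 1), 2 * (L : ℝ) := by
        refine Finset.sum_le_sum fun i _ => ?_
        have h := hy i
        rw [abs_le]
        simp only [Pi.sub_apply, Pi.smul_apply, smul_eq_mul]
        push_cast
        constructor <;> [skip; skip] <;> (have h1 : ((u i : ℤ) : ℝ) - 2 * (L : ℝ) < (L : ℝ) * (y i : ℝ) := by exact_mod_cast h.1) <;>
          (have h2 : (L : ℝ) * (y i : ℝ) ≤ ((u i : ℤ) : ℝ) := by exact_mod_cast h.2) <;> linarith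
    _ = ((d : ℝ) + 1) * (2 * (L : ℝ)) := by
        rw [Finset.sum_const, Finset.card_univ, Fintype.card_fin, nsmul_eq_mul]; push_cast; ring

/-- [folklore] PROXIMITY of the far endpoint of the coarse bond from its root: `|L·y + ρ + L·e_μ − u|₁ ≤ (d+1)·2L` for `y` in the near-set of `u` and a box root. -/
theorem l1_farEnd_sub_le_of_mem {L : ℕ} {r : Fin (d + 1) → ℕ} (hr : r ∈ box (d + 1) L) {u y : Fin (d + 1) → ℤ}
    (hy : ∀ i, u i - 2 * (L : ℤ) < (L : ℤ) * y i ∧ (L : ℤ) * y i ≤ u i) (μ : Fin (d + 1)) :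
    l1 ((L : ℤ) • y + toSite r + (L : ℤ) • unitVec μ - u) ≤ ((d : ℝ) + 1) * (2 * (L : ℝ)) := by
  have hri : ∀ i, (0 : ℤ) ≤ (r i : ℤ) ∧ (r i : ℤ) < L := by
    intro i
    have := Finset.mem_range.1 (Fintype.mem_piFinset.1 hr i)
    omega
  unfold l1
  calc ∑ ν, |((((L : ℤ) • y + toSite r + (L : ℤ) • unitVec μ - u) ν : ℤ) : ℝ)| ≤ ∑ _ν : Fin (d + 1), 2 * (L : ℝ) := by
        refine Finset.sum_le_sum fun i _ => ?_
        have h := hy i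
        have hr' := hri i
        have he : (0 : ℤ) ≤ unitVec μ i ∧ unitVec μ i ≤ 1 := by
          rw [AffineAveraging.unitVec_apply]; split_ifs <;> simp
        rw [abs_le]
        simp only [Pi.sub_apply, Pi.add_apply, Pi.smul_apply, smul_eq_mul, toSite]
        push_cast
        have h1 : ((u i : ℤ) : ℝ) - 2 * (L : ℝ) < (L : ℝ) * (y i : ℝ) := by exact_mod_cast h.1
        have h2 : (L : ℝ) * (y i : ℝ) ≤ ((u i : ℤ) : ℝ) := by exact_mod_cast h.2
        have h3 : (0 : ℝ) ≤ ((r i : ℕ) : ℝ) ∧ ((r i : ℕ) : ℝ) < (L : ℝ) := by exact_mod_cast hr'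
        have h4 : (0 : ℝ) ≤ ((unitVec μ i : ℤ) : ℝ) ∧ ((unitVec μ i : ℤ) : ℝ) ≤ 1 := by exact_mod_cast he
        have hL0 : (0 : ℝ) ≤ (L : ℝ) := Nat.cast_nonneg L
        have h5 : (L : ℝ) * ((unitVec μ i : ℤ) : ℝ) ≤ (L : ℝ) := by nlinarith [h4.2]
        have h6 : (0 : ℝ) ≤ (L : ℝ) * ((unitVec μ i : ℤ) : ℝ) := mul_nonneg hL0 h4.1
        constructor <;> linarith [h3.1, h3.2]
    _ = ((d : ℝ) + 1) * (2 * (L : ℝ)) := by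
        rw [Finset.sum_const, Finset.card_univ, Fintype.card_fin, nsmul_eq_mul]; push_cast; ring

end Partner

/-! ## §2 The index-slot law in `dψ`-form (an1's (S-V)ρ paired with any gauge function) -/

section Idx

/-- [folklore] **THE INDEX-SLOT PURE-GAUGE LAW OF THE ROOTED BORDER TABLE IN `dψ`-FORM** (box root; EVERY ψ): a pure-gauge background `dψ` in the
family index gives `Σ'_u Σ_κ (dz ψ) κ u · vhSAt ρ κ u x z a b = (ψ(legSite ρ z b) − ψ(legSite ρ x a)) · mfNeg (linSymAt ρ L) x z a b` — an1's (S-V)ρ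
`divV_vhSAt_apply` summed by parts (the multiplier leg acts at the ROOT `z + ρ` of its contours, a fluctuation leg at its own site). -/
theorem tsum_dz_mul_vhSAt_idx {L : ℕ} (hL : 1 ≤ L) {r : Fin (d + 1) → ℕ} (hr : r ∈ box (d + 1) L) (x z : Fin (d + 1) → ℤ) (a b : Fib d)
    (ψ : (Fin (d + 1) → ℤ) → ℝ) :
    ∑' u, ∑ κ, dz ψ κ u * vhSAt (toSite r) d L rfl κ u x z a b
      = (ψ (legSite (toSite r) z b) - ψ (legSite (toSite r) x a)) * mfNeg (linSymAt (toSite r) L) x z a b := by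
  classical
  rw [tsum_sum_dz_mul_eq (fun κ u => vhSAt (toSite r) d L rfl κ u x z a b)
    (fun κ g => summable_of_finsupp (nearBox L (blk L z) ∪ nearBox L (blk L x)) fun u hu => by
      rw [vhSAt_eq_zero_of_not_mem hr κ x z a b hu, mul_zero]) ψ]
  have hdiv : ∀ u, (∑ κ, (vhSAt (toSite r) d L rfl κ (u - unitVec κ) x z a b - vhSAt (toSite r) d L rfl κ u x z a b))
      = divV (vhSAt (toSite r) d L rfl) u x z a b := by
    intro u
    simp only [KernelWard.divV, Finset.sum_apply, Pi.sub_apply, b6UnitVec_eq]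
  simp only [hdiv, divV_vhSAt_apply hL, legInd_apply]
  exact tsum_mul_ite_sub_ite_mul ψ _ _ _

/-- [folklore] The index-slot law read on the `(inl α, inr μ)` block: `(ψ(z + ρ) − ψ x) · linSymAt ρ L x z (inl α) (inr μ)`. -/
theorem tsum_dz_mul_vhSAt_idx_inl_inr {L : ℕ} (hL : 1 ≤ L) {r : Fin (d + 1) → ℕ} (hr : r ∈ box (d + 1) L) (x z : Fin (d + 1) → ℤ)
    (α μ : Fin (d + 1)) (ψ : (Fin (d + 1) → ℤ) → ℝ) :
    ∑' u, ∑ κ, dz ψ κ u * vhSAt (toSite r) d L rfl κ u x z (Sum.inl α) (Sum.inr μ)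
      = (ψ (z + toSite r) - ψ x) * linSymAt (toSite r) L x z (Sum.inl α) (Sum.inr μ) := by
  rw [tsum_dz_mul_vhSAt_idx hL hr]; rfl

end Idx

/-! ## §3 The two contact kernels are enveloped at the leg site -/

section Weights

variable {N L : ℕ} {κ₀ : ℝ} {r : Fin (d + 1) → ℕ}

/-- [folklore] The weight of a gauge function at a site within `|·|₁ ≤ (d+1)·2L` of the leg site is enveloped at the leg site, with the factor `e^{2κ₀(d+1)L}`. -/
theorem abs_weight_le_of_l1_le (hN : 1 ≤ N) (hκ : 0 ≤ κ₀) {ψ : (Fin (d + 1) → ℤ) → ℝ} {Eψ : ℝ} (hE : 0 ≤ Eψ) {z₀ : Fin (d + 1) → ℤ}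
    (hψ : ∀ x, |ψ x| ≤ Eψ * Real.exp (-(κ₀ * supNorm (quo N x - z₀)))) {u a : Fin (d + 1) → ℤ}
    (ha : l1 (a - u) ≤ ((d : ℝ) + 1) * (2 * (L : ℝ))) :
    |ψ a| ≤ Eψ * Real.exp (κ₀ * (((d : ℝ) + 1) * (2 * (L : ℝ)))) * Real.exp (-(κ₀ * supNorm (quo N u - z₀))) := by
  have hw := env_wobble hN hκ z₀ u a
  calc |ψ a| ≤ Eψ * Real.exp (-(κ₀ * supNorm (quo N a - z₀))) := hψ a
    _ ≤ Eψ * (Real.exp (κ₀ * l1 (a - u)) * Real.exp (-(κ₀ * supNorm (quo N u - z₀)))) := mul_le_mul_of_nonneg_left hw hE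
    _ ≤ Eψ * (Real.exp (κ₀ * (((d : ℝ) + 1) * (2 * (L : ℝ)))) * Real.exp (-(κ₀ * supNorm (quo N u - z₀)))) := by gcongr
    _ = _ := by ring

/-- [folklore] **THE FLUCTUATION-SLOT CONTACT KERNEL IS ENVELOPED**: `|(ψ(u + e_κ) − ψ(z + ρ + L·e_μ))·q(u,z)(inl κ)(inr μ)| ≤ (2·Eψ·e^{2κ₀(d+1)L}·ℓ)·E_{z₀}(u)`
(both contact sites are within `(d+1)·2L` of `u` wherever `q ≠ 0`; `|q| ≤ ℓ`). -/
theorem abs_fluWeight_mul_linSymAt_le (hN : 1 ≤ N) (hκ : 0 ≤ κ₀) (hL : 1 ≤ L) (hr : r ∈ box (d + 1) L) {ψ : (Fin (d + 1) → ℤ) → ℝ} {Eψ : ℝ}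
    (hE : 0 ≤ Eψ) {z₀ : Fin (d + 1) → ℤ} (hψ : ∀ x, |ψ x| ≤ Eψ * Real.exp (-(κ₀ * supNorm (quo N x - z₀))))
    (κ : Fin (d + 1)) (u : Fin (d + 1) → ℤ) (μ : Fin (d + 1)) (z : Fin (d + 1) → ℤ) :
    |(ψ (u + unitVec κ) - ψ (z + toSite r + (L : ℤ) • unitVec μ)) * linSymAt (toSite r) L u z (Sum.inl κ) (Sum.inr μ)|
      ≤ (2 * Eψ * Real.exp (κ₀ * (((d : ℝ) + 1) * (2 * (L : ℝ)))) * (ell (d + 1) L : ℝ)) * Real.exp (-(κ₀ * supNorm (quo N u - z₀))) := by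
  by_cases hq : linSymAt (toSite r) L u z (Sum.inl κ) (Sum.inr μ) = 0
  · rw [hq, mul_zero, abs_zero]; positivity
  obtain ⟨hoff, hnear⟩ := off_eq_zero_and_near_of_linSymAt_ne_zero hr hq
  obtain ⟨s, _, hs, hprox⟩ := exists_finset_near_card (d := d) hL u
  have hy := hprox (blk L z) (hs _ hnear)
  have hz : z = (L : ℤ) • blk L z := eq_smul_blk_of_off_eq_zero hL hoff
  have hL1 : (1 : ℝ) ≤ ((d : ℝ) + 1) * (2 * (L : ℝ)) := by
    have : (1 : ℝ) ≤ L := by exact_mod_cast hL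
    nlinarith [show (0 : ℝ) ≤ d from Nat.cast_nonneg d]
  have htip : l1 (u + unitVec κ - u) ≤ ((d : ℝ) + 1) * (2 * (L : ℝ)) := by
    rw [add_sub_cancel_left, ← b6UnitVec_eq, l1_unitVec]; exact hL1
  have hfar : l1 (z + toSite r + (L : ℤ) • unitVec μ - u) ≤ ((d : ℝ) + 1) * (2 * (L : ℝ)) := by
    rw [hz]; exact l1_farEnd_sub_le_of_mem hr hy μ
  have h1 := abs_weight_le_of_l1_le hN hκ hE hψ htip
  have h2 := abs_weight_le_of_l1_le hN hκ hE hψ hfar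
  have hq' := abs_linSymAt_inl_inr_le hL hr κ u z μ
  rw [abs_mul]
  have h3 : |ψ (u + unitVec κ) - ψ (z + toSite r + (L : ℤ) • unitVec μ)|
      ≤ 2 * Eψ * Real.exp (κ₀ * (((d : ℝ) + 1) * (2 * (L : ℝ)))) * Real.exp (-(κ₀ * supNorm (quo N u - z₀))) := by
    have := abs_sub (ψ (u + unitVec κ)) (ψ (z + toSite r + (L : ℤ) • unitVec μ))
    linarith
  have h0 : 0 ≤ 2 * Eψ * Real.exp (κ₀ * (((d : ℝ) + 1) * (2 * (L : ℝ)))) * Real.exp (-(κ₀ * supNorm (quo N u - z₀))) := by positivity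
  calc |ψ (u + unitVec κ) - ψ (z + toSite r + (L : ℤ) • unitVec μ)| * |linSymAt (toSite r) L u z (Sum.inl κ) (Sum.inr μ)|
      ≤ (2 * Eψ * Real.exp (κ₀ * (((d : ℝ) + 1) * (2 * (L : ℝ)))) * Real.exp (-(κ₀ * supNorm (quo N u - z₀)))) * (ell (d + 1) L : ℝ) :=
        mul_le_mul h3 hq' (abs_nonneg _) h0
    _ = _ := by ring

/-- [folklore] **THE INDEX-SLOT CONTACT KERNEL IS ENVELOPED**: `|(ψ(z + ρ) − ψ x)·q(x,z)(inl α)(inr μ)| ≤ (2·Eψ·e^{2κ₀(d+1)L}·ℓ)·E_{z₀}(x)`. -/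
theorem abs_idxWeight_mul_linSymAt_le (hN : 1 ≤ N) (hκ : 0 ≤ κ₀) (hL : 1 ≤ L) (hr : r ∈ box (d + 1) L) {ψ : (Fin (d + 1) → ℤ) → ℝ} {Eψ : ℝ}
    (hE : 0 ≤ Eψ) {z₀ : Fin (d + 1) → ℤ} (hψ : ∀ x, |ψ x| ≤ Eψ * Real.exp (-(κ₀ * supNorm (quo N x - z₀))))
    (α : Fin (d + 1)) (x : Fin (d + 1) → ℤ) (μ : Fin (d + 1)) (z : Fin (d + 1) → ℤ) :
    |(ψ (z + toSite r) - ψ x) * linSymAt (toSite r) L x z (Sum.inl α) (Sum.inr μ)|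
      ≤ (2 * Eψ * Real.exp (κ₀ * (((d : ℝ) + 1) * (2 * (L : ℝ)))) * (ell (d + 1) L : ℝ)) * Real.exp (-(κ₀ * supNorm (quo N x - z₀))) := by
  by_cases hq : linSymAt (toSite r) L x z (Sum.inl α) (Sum.inr μ) = 0
  · rw [hq, mul_zero, abs_zero]; positivity
  obtain ⟨hoff, hnear⟩ := off_eq_zero_and_near_of_linSymAt_ne_zero hr hq
  obtain ⟨s, _, hs, hprox⟩ := exists_finset_near_card (d := d) hL x
  have hy := hprox (blk L z) (hs _ hnear)
  have hz : z = (L : ℤ) • blk L z := eq_smul_blk_of_off_eq_zero hL hoff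
  have hri : ∀ i, (0 : ℤ) ≤ (r i : ℤ) ∧ (r i : ℤ) < L := by
    intro i
    have := Finset.mem_range.1 (Fintype.mem_piFinset.1 hr i)
    omega
  have hroot : l1 (z + toSite r - x) ≤ ((d : ℝ) + 1) * (2 * (L : ℝ)) := by
    rw [hz]
    unfold l1
    calc ∑ ν, |((((L : ℤ) • blk L z + toSite r - x) ν : ℤ) : ℝ)| ≤ ∑ _ν : Fin (d + 1), 2 * (L : ℝ) := by
          refine Finset.sum_le_sum fun i _ => ?_
          have h := hy i
          have hr' := hri i
          rw [abs_le]
          simp only [Pi.sub_apply, Pi.add_apply, Pi.smul_apply, smul_eq_mul, toSite]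
          push_cast
          have h1 : ((x i : ℤ) : ℝ) - 2 * (L : ℝ) < (L : ℝ) * (blk L z i : ℝ) := by exact_mod_cast h.1
          have h2 : (L : ℝ) * (blk L z i : ℝ) ≤ ((x i : ℤ) : ℝ) := by exact_mod_cast h.2
          have h3 : (0 : ℝ) ≤ ((r i : ℕ) : ℝ) ∧ ((r i : ℕ) : ℝ) < (L : ℝ) := by exact_mod_cast hr'
          have hL0 : (0 : ℝ) ≤ (L : ℝ) := Nat.cast_nonneg L
          constructor <;> linarith [h3.1, h3.2]
      _ = ((d : ℝ) + 1) * (2 * (L : ℝ)) := by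
          rw [Finset.sum_const, Finset.card_univ, Fintype.card_fin, nsmul_eq_mul]; push_cast; ring
  have hsite : l1 (x - x) ≤ ((d : ℝ) + 1) * (2 * (L : ℝ)) := by
    rw [sub_self]; unfold l1; simp; positivity
  have h1 := abs_weight_le_of_l1_le hN hκ hE hψ hroot
  have h2 := abs_weight_le_of_l1_le hN hκ hE hψ hsite
  have hq' := abs_linSymAt_inl_inr_le hL hr α x z μ
  rw [abs_mul]
  have h3 : |ψ (z + toSite r) - ψ x| ≤ 2 * Eψ * Real.exp (κ₀ * (((d : ℝ) + 1) * (2 * (L : ℝ)))) * Real.exp (-(κ₀ * supNorm (quo N x - z₀))) := by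
    have := abs_sub (ψ (z + toSite r)) (ψ x)
    linarith
  have h0 : 0 ≤ 2 * Eψ * Real.exp (κ₀ * (((d : ℝ) + 1) * (2 * (L : ℝ)))) * Real.exp (-(κ₀ * supNorm (quo N x - z₀))) := by positivity
  calc |ψ (z + toSite r) - ψ x| * |linSymAt (toSite r) L x z (Sum.inl α) (Sum.inr μ)|
      ≤ (2 * Eψ * Real.exp (κ₀ * (((d : ℝ) + 1) * (2 * (L : ℝ)))) * Real.exp (-(κ₀ * supNorm (quo N x - z₀)))) * (ell (d + 1) L : ℝ) :=
        mul_le_mul h3 hq' (abs_nonneg _) h0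
    _ = _ := by ring

end Weights

end Summit.QuantumFields.BalabanUV.Beta.GAN24.ContactBorderPartner

end
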